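import Summits.QuantumFields.BalabanUV.Beta.FP.TorusCompositeCovarianceOneRows
import Summits.QuantumFields.BalabanUV.Beta.FP.TorusCompositeCovarianceOneSym

/-!
# `BalabanUV.Beta.FP.TorusCompositeCovarianceOneRowsSym` — road «FP» for binder row D1, ROUTE T, (β1) RE-BASING (ROW RULING R-D1-g52-1 (3)(c)), **(COV-m)
# ORDER 1 AT EVERY DEPTH FOR THE (0.4)-SYMMETRISED TOWER, PART 2 — THE `-Sym` DOOR's COMPOSITE ROWS `c1` ∕ `d1` BY TERM at the constant CENTRED root
# list**: `Q₁₁ · W₀ + Q₁₀ · W₁ = fromCols D̄₁ 0` with `Q₁₁ := c • compIns₁Sym …` (PART 1's chain-rule jet of the sym composite, weight `c`), `W₀ :=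
# towerGen …`, `W₁` the door's, `D̄₁` EXPLICIT (tip-type on every top bond); and `Q₂₁ · (σ_{n+1} • D̄) + Q₂₀ · D̄₁ = 0` with `Q₂₁ := Σ_{a′} (c·θ_{n+1}·
# (compRowsSym · h) a′) •` an1's (0.4)-SYMMETRISED first-order table at the centred root in the door's multiplier presentation, `Q₂₀` the top step's sym
# rows — the sym twins of leaf-02 g22∕g23's C2-Rows `torus_c1_tower ∕ torus_d1_tower`

WHY.  C2-Rows (`TorusCompositeCovarianceOneRows`) reads PART 1's all-columns law through the tower generators (`towerGen = D_finest · evalN`) and proves the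
door's composite `c1 ∕ d1` rows for the ROOTED tower.  The (β1) re-basing's `-Sym` door files (the OWNER d1-p3's (6) `NestedStepLawTorusCompositeOneShotTopSym`
v1.1) display `c1 ∕ d1` at the constant centred list `fun _ => ctrOff (d+1) Lc` with `Q₁₀ := compRowsSym …`, `Q₂₀ := (perF M′ (bhKStepSh d Lc (Dsh Lc) (lev
0)))↾((pμ′, inr mμ′) × fields)`; this file supplies them BY TERM from PART 1 (R-21 `compIns₁Sym_mul_tgrad`) and my g18 `PeriodisedSymBorderWardContact`.

WHAT (generic `d`; blocking `Lc`, `[NeZero Lc]`; `hc : ctrOff (d+1) Lc ∈ box (d+1) Lc` displayed; the constant centred list `fun _ => ctrOff (d+1) Lc`).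
§1 (the ROOTED §1 BY NAME, root-list-generic: `towerGen_eq_tgrad_mul_evalN`, `evalN_congr`, `evalN_itRoot_rootPt`, `W₁_eq_neg_smul_tip_mul_evalN`, read at
the constant centred list) **`torus_c1_towerSym (hc) (n c h) (hW₁)`**: `c • compIns₁Sym Lc M′ lev ρc (n+1) h * towerGen Lc M′ ρc (n+1) + compRowsSym Lc M′
lev ρc (n+1) * W₁ = fromCols (of (−c · (compRowsSym … *ᵥ h) a · [t̄ = a.1 + e_{a.2}])) 0` (`ρc := fun _ => ctrOff (d+1) Lc`; `W₁` the door's `hW₁`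
VERBATIM).  §2 `sum_smul_symVhSAt_mul_tgrad_res` (the top step's weighted (0.4)-symmetrised first-order table against the CENTRED comb's residual gauge
columns in ANY multiplier presentation is the tip contact — my g18 `submatrix_symVhSAt_mul_tgrad_of_not_root`), **`torus_d1_towerSym (hc) (hM′) (n c h)
(pμ′ mμ′)`** — (6)'s `d1` BY TERM with `Dbar := σ_{n+1} • D̄` as in R-20's `c0` and `Q₂₁` the transported direction one level up, `θ_{n+1} = Lc^{d+1}·
stepScale d Lc (lev 0) ∕ σ_{n+1}`.  C2-Rows' proofs VERBATIM under `compIns₁ ↦ compIns₁Sym`, `compRows ↦ compRowsSym`, `vhSAt (toSite (rs 0)) ↦ symVhSAt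
(ctr (d+1) Lc)`, `bhKStepAt d (toSite (rs 0)) Lc ↦ bhKStepSh d Lc (Dsh Lc)`, `itRoot … rs hrs ↦ itRoot … ρc (fun _ => hc)`.
NOT HERE: `c1 ∕ d1` with a free top comb root `ρs 0` (the door instantiates the constant list); ORDER 2 (`c2 d2`, the second chain rule over R-19's
`stepIns₂₂Sym`); any chart; any estimate.  [folklore] finite sums BY NAME over OUR bookkeeping objects and an1's typed tables; no `def`, no `def … : Prop`,
nothing cited, 0 sorry, default heartbeats.  Nothing of the dictionary ∕ Bałaban's non-linear averages asserted (the (β1) presentation is the ROW's ruling,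
quoted); NO chart fixed; the (C1) TABLES, the seven letters, `hH ∕ hQ` untouched.

HONEST DEPENDENCY (page 1, mandatory): continuum YM on T⁴ ⇐ BetaPertH ∧ nine spine estimates (0/9 proved); BetaPertH ⇐ (D1) ∧ (D4) ∧ CAP+tail;
G-an2-4 gates asym, D1 and NE2/3/4.  HONEST FRAMING (cell contract, verbatim): «discharging `BetaPertH` makes Bałaban's UV stability UNCONDITIONAL —
a real constructive-QFT result; it is NOT the continuum limit and NOT the Clay problem.»  ABSOLUTE RULE (cell charter, verbatim): «No internally-minted
statement may enter as a cited fact. Every hypothesis is either kernel-proved in this package or a verbatim quotation of a PUBLISHED theorem with page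
reference. The manuscript(s) under audit are NOT citable for their own disputed steps — they are the thing under adjudication; programme-internal
(2001/route/tribunal) claims are never citable.»  0 estimates; 0∕4 row-D1 binders (hW, hR, D1Tel, D1Rep); NOT (T-ID), NOT (C1), NOT SDF, NOT D1,
NOT BetaPertH, NOT continuum, NOT Clay.  D1 formalisation swarm LEAF PROVER 02 (b2b-balaban-beta-d1-formalise-leaf-02 gen 32), 2026-08-24.  No existing file touched.
-/

noncomputable section

open scoped BigOperators

namespace Summit.QuantumFields.BalabanUV.Beta.FP.TorusCompositeCovarianceOneRowsSym

open Matrix Finset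
open Literature.Probability.LatticeModels (Torus.proj)
open Literature.MathematicalPhysics.QuantumFieldTheory
open Literature.MathematicalPhysics.QuantumFieldTheory.Balaban1983to89
open Literature.MathematicalPhysics.QuantumFieldTheory.Balaban1983to89.Beta
open B5Prop11Plancherel (fine)
open B6Lemma24Torus (pbox mem_pbox)
open AffineAveraging (Site box toSite unitVec)
open AveragingContoursRooted (ctr ctrOff ctrOff_mem_box)
open LatticeForm (quo)
open OneStepResolventKernel (Fib)
open Summit.QuantumFields.BalabanUV.Beta.BorderedHessian (stepScale stepScale_ne_zero)
open Summit.QuantumFields.BalabanUV.Beta.SymAveragingHessianCounts (symVhSAt)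
open Summit.QuantumFields.BalabanUV.Beta.SymShiftedSpread (bhKStepSh)
open Summit.QuantumFields.BalabanUV.Beta.DshAn1 (Dsh)
open Summit.QuantumFields.BalabanUV.Beta.FP.KernelPeriodisationFib (Idx perF)
open Summit.QuantumFields.BalabanUV.Beta.FP.KernelPeriodisationFibLoc (dper)
open Summit.QuantumFields.BalabanUV.Beta.FP.TorusGaugeCovariance (tdelta tgrad)
open Summit.QuantumFields.BalabanUV.Beta.FP.TorusGaugeCovariancePairing (wrapPt wrapPt_coe wrapPt_of_mem tdelta_eq_ite_wrapPt)
open Summit.QuantumFields.BalabanUV.Beta.FP.TorusGaugeCovarianceCoarse (tgradBlock coarsePt)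
open Summit.QuantumFields.BalabanUV.Beta.FP.TorusCombRows (Res ne_rootOf_iff_proj_ne)
open Summit.QuantumFields.BalabanUV.Beta.GAN24.FineReadoutCauchyFrame (toSite_mem_range)
open Summit.QuantumFields.BalabanUV.Beta.FP.PeriodisedSymBorderWardContact (submatrix_symVhSAt_mul_tgrad_of_not_root)
open Summit.QuantumFields.BalabanUV.Beta.FP.TorusCompositeObjects
open Summit.QuantumFields.BalabanUV.Beta.FP.TorusCompositeObjectsG (QstepSym QSym compRowsSym)
open Summit.QuantumFields.BalabanUV.Beta.FP.TorusCompositeCovariance (rootPt rootPt_coe itRoot itRoot_zero itRoot_succ quo_itRoot)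
open Summit.QuantumFields.BalabanUV.Beta.FP.TorusCompositeFP (evalN evalN_zero evalN_succ)
open Summit.QuantumFields.BalabanUV.Beta.FP.TorusCompositeCovarianceOne (tdelta_wrapPt of_tdelta_mul prod_stepScale_mul_card_ne_zero')
open Summit.QuantumFields.BalabanUV.Beta.FP.TorusCompositeCovarianceOneRows (towerGen_eq_tgrad_mul_evalN evalN_congr evalN_itRoot_rootPt
  W₁_eq_neg_smul_tip_mul_evalN)
open Summit.QuantumFields.BalabanUV.Beta.FP.TorusCompositeCovarianceOneSym (compIns₁Sym compIns₁Sym_mul_tgrad)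

variable {d : ℕ} (Lc : ℕ) [NeZero Lc]

section Rows

variable (M' : Fin (d + 1) → ℕ) [∀ μ, NeZero (M' μ)] (lev : ℕ → ℕ)

/-! ## §1 The `-Sym` door's composite covariance row `c1` at the constant centred root list -/

/-- [folklore] **`torus_c1_towerSym` — (COV-m) ORDER 1: THE `-Sym` DOOR's COMPOSITE COVARIANCE ROW `c1` AT EVERY DEPTH**, constant centred root list
`ρc := fun _ => ctrOff (d+1) Lc`.  With `Q₁₁ := c • compIns₁Sym Lc M′ lev ρc (n+1) h` (PART 1's chain-rule jet of the sym composite along `h`, weight `c` = the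
transport generator's), `W₀ := towerGen …`, `W₁` the door's `hW₁` VERBATIM: `Q₁₁ · W₀ + Q₁₀ · W₁ = fromCols D̄₁ 0`, `D̄₁(a, t̄) = −c · (compRowsSym … (n+1) · h) a ·
[t̄ = a.1 + e_{a.2}]` — the sym composite insertion jet's coarse image is the TIP-type jet of the transported direction `compRowsSym · h` on EVERY top bond, and
every lower generator is killed.  C2-Rows' `torus_c1_tower` VERBATIM (PART 1's all-columns law through `towerGen = D · evalN`; tip term `= −Q₁₀·W₁`; far-root
term: top block by `quo_itRoot`, lower blocks by `evalN_itRoot_rootPt` — both read at the constant centred list). -/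
theorem torus_c1_towerSym (hc : ctrOff (d + 1) Lc ∈ box (d + 1) Lc) (n : ℕ) (c : ℝ) (h : ↥(pbox (towerTorus Lc M' (n + 1))) × Fin (d + 1) → ℝ)
    {W₁ : Matrix (↥(pbox (towerTorus Lc M' (n + 1))) × Fin (d + 1)) (NParam Lc M' (fun _ => ctrOff (d + 1) Lc) (n + 1)) ℝ}
    (hW₁ : W₁ = Matrix.of fun (b : (↥(pbox (towerTorus Lc M' (n + 1))) × Fin (d + 1))) (e : NParam Lc M' (fun _ => ctrOff (d + 1) Lc) (n + 1)) =>
      -(c * h b * evalN Lc M' (fun _ => ctrOff (d + 1) Lc) (n + 1)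
        (fun b' : (↥(pbox (towerTorus Lc M' (n + 1))) × Fin (d + 1)) => (b'.1 : Site (d + 1)) + unitVec b'.2) b e)) :
    c • compIns₁Sym Lc M' lev (fun _ => ctrOff (d + 1) Lc) (n + 1) h * towerGen Lc M' (fun _ => ctrOff (d + 1) Lc) (n + 1)
        + compRowsSym Lc M' lev (fun _ => ctrOff (d + 1) Lc) (n + 1) * W₁
      = Matrix.fromCols
          (Matrix.of fun (a : ↥(pbox M') × Fin (d + 1)) (t : Res (toSite (ctrOff (d + 1) Lc)) Lc M') =>
            -(c * (compRowsSym Lc M' lev (fun _ => ctrOff (d + 1) Lc) (n + 1) *ᵥ h) a * tdelta M' ((a.1 : Site (d + 1)) + unitVec a.2) t.1))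
          (0 : Matrix (↥(pbox M') × Fin (d + 1)) (NParam Lc (fine Lc M') (fun _ => ctrOff (d + 1) Lc) n) ℝ) := by
  -- the far-root contact through the point-evaluation matrix, weighted by `−c`: top block = the coarse jet, lower blocks vanish
  have hfar : -(c • (Matrix.of (fun (a : ↥(pbox M') × Fin (d + 1)) (s : ↥(pbox (towerTorus Lc M' (n + 1)))) =>
        (compRowsSym Lc M' lev (fun _ => ctrOff (d + 1) Lc) (n + 1) *ᵥ h) a
          * tdelta (towerTorus Lc M' (n + 1))
              ((itRoot Lc M' (fun _ => ctrOff (d + 1) Lc) (fun _ => hc) (n + 1) (wrapPt M' ((a.1 : Site (d + 1)) + unitVec a.2)) :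
                ↥(pbox (towerTorus Lc M' (n + 1)))) : Site (d + 1)) s)
        * evalN Lc M' (fun _ => ctrOff (d + 1) Lc) (n + 1) (fun s : ↥(pbox (towerTorus Lc M' (n + 1))) => (s : Site (d + 1)))))
      = Matrix.fromCols
          (Matrix.of fun (a : ↥(pbox M') × Fin (d + 1)) (t : Res (toSite (ctrOff (d + 1) Lc)) Lc M') =>
            -(c * (compRowsSym Lc M' lev (fun _ => ctrOff (d + 1) Lc) (n + 1) *ᵥ h) a * tdelta M' ((a.1 : Site (d + 1)) + unitVec a.2) t.1))
          (0 : Matrix (↥(pbox M') × Fin (d + 1)) (NParam Lc (fine Lc M') (fun _ => ctrOff (d + 1) Lc) n) ℝ) := by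
    rw [of_tdelta_mul, evalN_succ]
    ext a e
    rcases e with t | e
    · simp only [Matrix.neg_apply, Matrix.smul_apply, Matrix.of_apply, Matrix.fromCols_apply_inl, wrapPt_of_mem, smul_eq_mul]
      rw [bigRatio_eq_pow, quo_itRoot, tdelta_wrapPt]
      ring
    · simp only [Matrix.neg_apply, Matrix.smul_apply, Matrix.of_apply, Matrix.fromCols_apply_inr, Matrix.zero_apply, wrapPt_of_mem, smul_eq_mul, itRoot_succ]
      dsimp only [towerTorus_succ]
      rw [evalN_itRoot_rootPt Lc n M' (fun _ => ctrOff (d + 1) Lc) (fun _ => hc), mul_zero, mul_zero, neg_zero]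
  rw [hW₁, W₁_eq_neg_smul_tip_mul_evalN, towerGen_eq_tgrad_mul_evalN Lc (n + 1) M' (fun _ => ctrOff (d + 1) Lc), Matrix.smul_mul, ← Matrix.mul_assoc,
    compIns₁Sym_mul_tgrad Lc hc (n + 1) M' lev (fun _ => ctrOff (d + 1) Lc) h, ← hfar, Matrix.sub_mul, smul_sub, Matrix.mul_neg, Matrix.mul_smul,
    ← Matrix.mul_assoc]
  abel

/-! ## §2 The top step's sym coarse covariance row `d1` along the transported direction -/

variable {Lc M'} in
/-- [folklore] **THE TOP STEP's WEIGHTED (0.4)-SYMMETRISED FIRST-ORDER TABLE AGAINST THE CENTRED COMB's RESIDUAL GAUGE COLUMNS IS THE TIP CONTACT**, in ANY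
multiplier presentation `k ↦ (pμ′ k, inr (mμ′ k))` (my g18 `submatrix_symVhSAt_mul_tgrad_of_not_root`; `Lc ∣ M′`, any level `ℓ` on the right):
`(Σ_{a′} v a′ • T^{a′}_sym) · D̄ = c_ℓ • Q₂₀^sym · (v b · [t̄ = b.1 + e_{b.2}])` — the sym twin of C2-Rows' `sum_smul_vhSAt_mul_tgrad_res`. -/
theorem sum_smul_symVhSAt_mul_tgrad_res (hc : ctrOff (d + 1) Lc ∈ box (d + 1) Lc) (hM' : ∀ i, Lc ∣ M' i) (ℓ : ℕ)
    {κ : Type*} (pμ' : κ → ↥(pbox M')) (mμ' : κ → Fin (d + 1)) (v : ↥(pbox M') × Fin (d + 1) → ℝ) :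
    (∑ a' : ↥(pbox M') × Fin (d + 1), v a' •
        (perF M' (dper M' (symVhSAt (ctr (d + 1) Lc) d Lc rfl a'.2 (a'.1 : Site (d + 1))))).submatrix (fun k : κ => ((pμ' k, Sum.inr (mμ' k)) : Idx M' (Fib d)))
          (fun b : ↥(pbox M') × Fin (d + 1) => ((b.1, Sum.inl b.2) : Idx M' (Fib d))))
        * (tgrad M').submatrix (fun a : ↥(pbox M') × Fin (d + 1) => ((a.1, Sum.inl a.2) : Idx M' (Fib d)))
            (fun t : Res (toSite (ctrOff (d + 1) Lc)) Lc M' => (t.1 : ↥(pbox M')))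
      = ((Lc : ℝ) ^ (d + 1) * stepScale d Lc ℓ)⁻¹ •
          ((perF M' (bhKStepSh d Lc (Dsh Lc) ℓ)).submatrix (fun k : κ => ((pμ' k, Sum.inr (mμ' k)) : Idx M' (Fib d)))
              (fun b : ↥(pbox M') × Fin (d + 1) => ((b.1, Sum.inl b.2) : Idx M' (Fib d)))
            * Matrix.of (fun (b : ↥(pbox M') × Fin (d + 1)) (t : Res (toSite (ctrOff (d + 1) Lc)) Lc M') =>
                v b * tdelta M' ((b.1 : Site (d + 1)) + unitVec b.2) t.1)) := by
  have hL0 : 0 < Lc := Nat.pos_of_ne_zero (NeZero.ne Lc)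
  ext k t
  have key : ∀ a' : ↥(pbox M') × Fin (d + 1),
      ((perF M' (dper M' (symVhSAt (ctr (d + 1) Lc) d Lc rfl a'.2 (a'.1 : Site (d + 1))))).submatrix (fun k : κ => ((pμ' k, Sum.inr (mμ' k)) : Idx M' (Fib d)))
            (fun b : ↥(pbox M') × Fin (d + 1) => ((b.1, Sum.inl b.2) : Idx M' (Fib d)))
          * (tgrad M').submatrix (fun a : ↥(pbox M') × Fin (d + 1) => ((a.1, Sum.inl a.2) : Idx M' (Fib d)))
              (fun t : Res (toSite (ctrOff (d + 1) Lc)) Lc M' => (t.1 : ↥(pbox M')))) k t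
        = tdelta M' ((a'.1 : Site (d + 1)) + unitVec a'.2) t.1
          * ((((Lc : ℝ) ^ (d + 1) * stepScale d Lc ℓ)⁻¹)
            * (perF M' (bhKStepSh d Lc (Dsh Lc) ℓ)).submatrix (fun k : κ => ((pμ' k, Sum.inr (mμ' k)) : Idx M' (Fib d)))
                (fun b : ↥(pbox M') × Fin (d + 1) => ((b.1, Sum.inl b.2) : Idx M' (Fib d))) k a') := fun a' =>
    submatrix_symVhSAt_mul_tgrad_of_not_root (M := M') (M' := fun i => M' i / Lc) (fun i => (Nat.mul_div_cancel' (hM' i)).symm) ℓ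
      (fun k : κ => (pμ' k : Site (d + 1))) (fun k => (pμ' k).2) mμ' (fun t : Res (toSite (ctrOff (d + 1) Lc)) Lc M' => (t.1 : ↥(pbox M')))
      (fun t => (ne_rootOf_iff_proj_ne hL0 (toSite_mem_range hc) _).1 t.2) a'.2 a'.1 k t
  rw [Matrix.sum_mul, Matrix.sum_apply]
  simp only [Matrix.smul_mul, Matrix.smul_apply, smul_eq_mul, key]
  simp only [Matrix.mul_apply, Matrix.of_apply, Finset.mul_sum]
  exact Finset.sum_congr rfl fun a' _ => by ring

/-- [folklore] **`torus_d1_towerSym` — (COV-m) ORDER 1: THE TOP STEP's SYM COARSE COVARIANCE ROW `d1` AT EVERY DEPTH**, constant centred root list.  With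
`Dbar := σ_{n+1} • D̄` (R-20's `c0`, `compRowsSym_mul_towerGen_succ`), `Q₂₀` the `-Sym` door's `hQ₂₀` VERBATIM (level `lev 0`, presentation `(pμ′, mμ′)`), `D̄₁`
from `torus_c1_towerSym`, and `Q₂₁ := Σ_{a′} (c·θ_{n+1}·(compRowsSym … (n+1) · h) a′) •` an1's (0.4)-symmetrised first-order table `symVhSAt (ctr (d+1) Lc) a′`
in the door's presentation — the coarse door's sym insertion jet along the direction TRANSPORTED ONE LEVEL UP, `θ_{n+1} = Lc^{d+1}·stepScale d Lc (lev 0) ∕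
σ_{n+1}`: `Q₂₁ · Dbar + Q₂₀ · D̄₁ = 0` (`sum_smul_symVhSAt_mul_tgrad_res`: both terms are `± c • Q₂₀ ·` the tip contact of `compRowsSym · h`).  C2-Rows'
`torus_d1_tower` VERBATIM under the substitution. -/
theorem torus_d1_towerSym (hc : ctrOff (d + 1) Lc ∈ box (d + 1) Lc) (hM' : ∀ i, Lc ∣ M' i) (n : ℕ) (c : ℝ)
    (h : ↥(pbox (towerTorus Lc M' (n + 1))) × Fin (d + 1) → ℝ) {κ : Type*} (pμ' : κ → ↥(pbox M')) (mμ' : κ → Fin (d + 1)) :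
    (∑ a' : ↥(pbox M') × Fin (d + 1),
        ((c * (((Lc : ℝ) ^ (d + 1) * stepScale d Lc (lev 0)) * (∏ i ∈ range (n + 1), (stepScale d Lc (lev (i + 1)) * ((box (d + 1) Lc).card : ℝ)))⁻¹))
          * (compRowsSym Lc M' lev (fun _ => ctrOff (d + 1) Lc) (n + 1) *ᵥ h) a') •
        (perF M' (dper M' (symVhSAt (ctr (d + 1) Lc) d Lc rfl a'.2 (a'.1 : Site (d + 1))))).submatrix (fun k : κ => ((pμ' k, Sum.inr (mμ' k)) : Idx M' (Fib d)))
          (fun b : ↥(pbox M') × Fin (d + 1) => ((b.1, Sum.inl b.2) : Idx M' (Fib d))))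
        * ((∏ i ∈ range (n + 1), (stepScale d Lc (lev (i + 1)) * ((box (d + 1) Lc).card : ℝ))) •
            (tgrad M').submatrix (fun a : ↥(pbox M') × Fin (d + 1) => ((a.1, Sum.inl a.2) : Idx M' (Fib d)))
              (fun t : Res (toSite (ctrOff (d + 1) Lc)) Lc M' => (t.1 : ↥(pbox M'))))
      + (perF M' (bhKStepSh d Lc (Dsh Lc) (lev 0))).submatrix (fun a : κ => ((pμ' a, Sum.inr (mμ' a)) : Idx M' (Fib d)))
          (fun b : ↥(pbox M') × Fin (d + 1) => ((b.1, Sum.inl b.2) : Idx M' (Fib d)))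
        * Matrix.of (fun (a : ↥(pbox M') × Fin (d + 1)) (t : Res (toSite (ctrOff (d + 1) Lc)) Lc M') =>
            -(c * (compRowsSym Lc M' lev (fun _ => ctrOff (d + 1) Lc) (n + 1) *ᵥ h) a * tdelta M' ((a.1 : Site (d + 1)) + unitVec a.2) t.1))
      = 0 := by
  have hB : (box (d + 1) Lc).Nonempty := ⟨ctrOff (d + 1) Lc, hc⟩
  have hσ := prod_stepScale_mul_card_ne_zero' Lc hB (fun i => lev (i + 1)) (n + 1)
  have hL : (Lc : ℝ) ^ (d + 1) * stepScale d Lc (lev 0) ≠ 0 := mul_ne_zero (pow_ne_zero _ (by exact_mod_cast NeZero.ne Lc)) (stepScale_ne_zero _)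
  have hθ : (∏ i ∈ range (n + 1), (stepScale d Lc (lev (i + 1)) * ((box (d + 1) Lc).card : ℝ))) * ((Lc : ℝ) ^ (d + 1) * stepScale d Lc (lev 0))⁻¹
      * (c * (((Lc : ℝ) ^ (d + 1) * stepScale d Lc (lev 0)) * (∏ i ∈ range (n + 1), (stepScale d Lc (lev (i + 1)) * ((box (d + 1) Lc).card : ℝ)))⁻¹)) = c := by
    rw [show (∏ i ∈ range (n + 1), (stepScale d Lc (lev (i + 1)) * ((box (d + 1) Lc).card : ℝ))) * ((Lc : ℝ) ^ (d + 1) * stepScale d Lc (lev 0))⁻¹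
        * (c * (((Lc : ℝ) ^ (d + 1) * stepScale d Lc (lev 0)) * (∏ i ∈ range (n + 1), (stepScale d Lc (lev (i + 1)) * ((box (d + 1) Lc).card : ℝ)))⁻¹))
        = c * ((∏ i ∈ range (n + 1), (stepScale d Lc (lev (i + 1)) * ((box (d + 1) Lc).card : ℝ)))
            * (∏ i ∈ range (n + 1), (stepScale d Lc (lev (i + 1)) * ((box (d + 1) Lc).card : ℝ)))⁻¹)
          * (((Lc : ℝ) ^ (d + 1) * stepScale d Lc (lev 0)) * ((Lc : ℝ) ^ (d + 1) * stepScale d Lc (lev 0))⁻¹) by ring,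
      mul_inv_cancel₀ hσ, mul_inv_cancel₀ hL, mul_one, mul_one]
  have e1 : Matrix.of (fun (b : ↥(pbox M') × Fin (d + 1)) (t : Res (toSite (ctrOff (d + 1) Lc)) Lc M') =>
        (c * (((Lc : ℝ) ^ (d + 1) * stepScale d Lc (lev 0)) * (∏ i ∈ range (n + 1), (stepScale d Lc (lev (i + 1)) * ((box (d + 1) Lc).card : ℝ)))⁻¹))
          * (compRowsSym Lc M' lev (fun _ => ctrOff (d + 1) Lc) (n + 1) *ᵥ h) b * tdelta M' ((b.1 : Site (d + 1)) + unitVec b.2) t.1)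
      = (c * (((Lc : ℝ) ^ (d + 1) * stepScale d Lc (lev 0)) * (∏ i ∈ range (n + 1), (stepScale d Lc (lev (i + 1)) * ((box (d + 1) Lc).card : ℝ)))⁻¹)) •
          Matrix.of (fun (b : ↥(pbox M') × Fin (d + 1)) (t : Res (toSite (ctrOff (d + 1) Lc)) Lc M') =>
            (compRowsSym Lc M' lev (fun _ => ctrOff (d + 1) Lc) (n + 1) *ᵥ h) b * tdelta M' ((b.1 : Site (d + 1)) + unitVec b.2) t.1) := by
    ext b t; simp only [Matrix.of_apply, Matrix.smul_apply, smul_eq_mul, mul_assoc]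
  have e2 : Matrix.of (fun (a : ↥(pbox M') × Fin (d + 1)) (t : Res (toSite (ctrOff (d + 1) Lc)) Lc M') =>
        -(c * (compRowsSym Lc M' lev (fun _ => ctrOff (d + 1) Lc) (n + 1) *ᵥ h) a * tdelta M' ((a.1 : Site (d + 1)) + unitVec a.2) t.1))
      = -(c • Matrix.of (fun (b : ↥(pbox M') × Fin (d + 1)) (t : Res (toSite (ctrOff (d + 1) Lc)) Lc M') =>
            (compRowsSym Lc M' lev (fun _ => ctrOff (d + 1) Lc) (n + 1) *ᵥ h) b * tdelta M' ((b.1 : Site (d + 1)) + unitVec b.2) t.1)) := by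
    ext a t; simp only [Matrix.of_apply, Matrix.neg_apply, Matrix.smul_apply, smul_eq_mul, mul_assoc]
  rw [Matrix.mul_smul, sum_smul_symVhSAt_mul_tgrad_res hc hM' (lev 0) pμ' mμ', e1, e2, Matrix.mul_smul, smul_smul, smul_smul, hθ, Matrix.mul_neg,
    Matrix.mul_smul, add_neg_cancel]

end Rows

end Summit.QuantumFields.BalabanUV.Beta.FP.TorusCompositeCovarianceOneRowsSym

end
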